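import Mathlib

/-!
# PneNP / ConvexRankGates — `ConvexGateBlind`, symmetric LP certificates I: Bochert's bound (1889)

Helpers (`--supports stmt-PneNP-10680`). The symmetric form of the junta-blindness theorem (`…JuntaBlind.lean`,
`…StabiliserBlind.lean`: local / stabiliser-invariant LP certificates are `ε`-exactly blind on a balanced colouring
column) needs ONE piece of classical group theory — Yannakakis' lemma (Yannakakis 1991, Claim 2; Kaibel–Pashkovich–Theis
2012, Lemma 12): a subgroup of `Sym(m)` of index `< C(m, k)` contains every even permutation fixing some set of fewer than
`k` points. Its proof rests on BOCHERT'S BOUND, proved in THIS FILE from Jordan's theorem (Mathlib,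
`Equiv.Perm.alternatingGroup_le_of_isPreprimitive_of_isThreeCycle_mem`):

* `isThreeCycle_comm_of_support_inter` — if the supports of two permutations meet in exactly one point, their commutator
  is a 3-cycle;
* `bochert_bound` — a primitive subgroup `G ≤ Sym(α)` not containing `Alt(α)` satisfies `⌈|α|/2⌉! · |G| ≤ |α|!`
  (index at least `⌈|α|/2⌉!`). Proof (Cameron, *Permutation Groups*, Ex. 4.22): take `Γ ⊆ α` of maximal size such that
  no non-identity element of `G` is supported inside `Γ`; elements of `G` are then determined by their restriction to `Γᶜ`,
  so `|G| ≤ |α|!/|Γ|!`; and if `2|Γ| < |α|`, maximality yields non-identity `g, h ∈ G` supported in `Γᶜ` and in `Γ + a`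
  (`a ∈ supp g`), whose supports meet in `{a}` — their commutator is a 3-cycle and Jordan's theorem gives `Alt(α) ≤ G`.

[Bochert 1889; Cameron 1999, Ex. 4.22; Dixon–Mortimer Thm 3.3B]
-/

set_option linter.dupNamespace false

namespace Summit.PneNP.PneNP.Theorems

open Equiv Equiv.Perm Finset Nat

variable {α : Type*} [Fintype α] [DecidableEq α]

omit [Fintype α] [DecidableEq α] in
/-- `f (f⁻¹ x) = x` for a permutation `f`. [folklore] -/
theorem perm_apply_inv_self (f : Perm α) (x : α) : f (f⁻¹ x) = x := f.apply_symm_apply x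

omit [Fintype α] [DecidableEq α] in
/-- `f⁻¹ (f x) = x` for a permutation `f`. [folklore] -/
theorem perm_inv_apply_self (f : Perm α) (x : α) : f⁻¹ (f x) = x := f.symm_apply_apply x

/-! ## The commutator of two permutations whose supports meet in one point -/

/-- If the supports of `g` and `h` meet exactly in `{a}`, then the commutator `g h g⁻¹ h⁻¹` is the 3-cycle
`a ↦ g a ↦ h a ↦ a`. [folklore; Cameron 1999, §6.1] -/
theorem isThreeCycle_comm_of_support_inter {g h : Perm α} {a : α} (hgh : g.support ∩ h.support = {a}) :
    IsThreeCycle (g * h * g⁻¹ * h⁻¹) := by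
  -- basic facts about the configuration
  have ha : a ∈ g.support ∧ a ∈ h.support := by
    have : a ∈ g.support ∩ h.support := by rw [hgh]; exact mem_singleton_self a
    exact mem_inter.1 this
  have hg_not_h : ∀ x, x ∈ g.support → x ≠ a → x ∉ h.support := fun x hx hxa hxh => by
    have : x ∈ g.support ∩ h.support := mem_inter.2 ⟨hx, hxh⟩
    rw [hgh, mem_singleton] at this
    exact hxa this
  have hh_not_g : ∀ x, x ∈ h.support → x ≠ a → x ∉ g.support := fun x hx hxa hxg =>
    hg_not_h x hxg hxa hx
  have hga : g a ≠ a := mem_support.1 ha.1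
  have hha : h a ≠ a := mem_support.1 ha.2
  -- `g a` is fixed by `h`, `h a` is fixed by `g`
  have hga_g : g a ∈ g.support := apply_mem_support.2 ha.1
  have hha_h : h a ∈ h.support := apply_mem_support.2 ha.2
  have h_ga : h (g a) = g a := notMem_support.1 (hg_not_h _ hga_g hga)
  have g_ha : g (h a) = h a := notMem_support.1 (hh_not_g _ hha_h hha)
  have hdist : g a ≠ h a := fun heq => hg_not_h _ hga_g hga (heq ▸ hha_h)
  -- `g⁻¹ a` is fixed by `h`, `h⁻¹ a` is fixed by `g`
  have hgia : g⁻¹ a ∈ g.support := by rw [← support_inv]; exact apply_mem_support.2 (by rw [support_inv]; exact ha.1)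
  have hhia : h⁻¹ a ∈ h.support := by rw [← support_inv]; exact apply_mem_support.2 (by rw [support_inv]; exact ha.2)
  have hgia_ne : g⁻¹ a ≠ a := fun heq => hga (by rw [Perm.inv_eq_iff_eq] at heq; exact heq.symm)
  have hhia_ne : h⁻¹ a ≠ a := fun heq => hha (by rw [Perm.inv_eq_iff_eq] at heq; exact heq.symm)
  have h_gia : h (g⁻¹ a) = g⁻¹ a := notMem_support.1 (hg_not_h _ hgia hgia_ne)
  have gi_hia : g⁻¹ (h⁻¹ a) = h⁻¹ a := by
    have : g (h⁻¹ a) = h⁻¹ a := notMem_support.1 (hh_not_g _ hhia hhia_ne)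
    rw [Perm.inv_eq_iff_eq]; exact this.symm
  -- the three values of the commutator
  set c : Perm α := g * h * g⁻¹ * h⁻¹ with hc
  have hc_apply : ∀ x, c x = g (h (g⁻¹ (h⁻¹ x))) := fun x => by simp [hc, Perm.mul_apply]
  have c_a : c a = g a := by rw [hc_apply, gi_hia, perm_apply_inv_self]
  have c_ga : c (g a) = h a := by
    rw [hc_apply]
    have : h⁻¹ (g a) = g a := by rw [Perm.inv_eq_iff_eq]; exact h_ga.symm
    rw [this, perm_inv_apply_self, g_ha]
  have c_ha : c (h a) = a := by
    rw [hc_apply, perm_inv_apply_self, h_gia, perm_apply_inv_self]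
  -- every other point is fixed
  have c_fix : ∀ x, x ≠ a → x ≠ g a → x ≠ h a → c x = x := by
    intro x hxa hxga hxha
    rw [hc_apply]
    by_cases hxg : x ∈ g.support
    · have hxh : x ∉ h.support := hg_not_h x hxg hxa
      have e1 : h⁻¹ x = x := by rw [Perm.inv_eq_iff_eq]; exact (notMem_support.1 hxh).symm
      have hz : g⁻¹ x ∈ g.support := by
        rw [← support_inv]; exact apply_mem_support.2 (by rw [support_inv]; exact hxg)
      have hza : g⁻¹ x ≠ a := fun heq => hxga (by rw [Perm.inv_eq_iff_eq] at heq; exact heq)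
      have e2 : h (g⁻¹ x) = g⁻¹ x := notMem_support.1 (hg_not_h _ hz hza)
      rw [e1, e2, perm_apply_inv_self]
    · by_cases hxh : x ∈ h.support
      · have hy : h⁻¹ x ∈ h.support := by
          rw [← support_inv]; exact apply_mem_support.2 (by rw [support_inv]; exact hxh)
        have hya : h⁻¹ x ≠ a := fun heq => hxha (by rw [Perm.inv_eq_iff_eq] at heq; exact heq)
        have e1 : g⁻¹ (h⁻¹ x) = h⁻¹ x := by
          have : g (h⁻¹ x) = h⁻¹ x := notMem_support.1 (hh_not_g _ hy hya)
          rw [Perm.inv_eq_iff_eq]; exact this.symm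
        rw [e1, perm_apply_inv_self, notMem_support.1 hxg]
      · have e1 : h⁻¹ x = x := by rw [Perm.inv_eq_iff_eq]; exact (notMem_support.1 hxh).symm
        have e2 : g⁻¹ x = x := by rw [Perm.inv_eq_iff_eq]; exact (notMem_support.1 hxg).symm
        rw [e1, e2, notMem_support.1 hxh, notMem_support.1 hxg]
  -- hence the support is `{a, g a, h a}`
  have hsupp : c.support = {a, g a, h a} := by
    ext x
    simp only [mem_support, mem_insert, mem_singleton]
    constructor
    · intro hx
      by_contra hnot
      push Not at hnot
      exact hx (c_fix x hnot.1 hnot.2.1 hnot.2.2)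
    · rintro (rfl | rfl | rfl)
      · rw [c_a]; exact hga
      · rw [c_ga]; exact hdist.symm
      · rw [c_ha]; exact hha.symm
  rw [← card_support_eq_three_iff, hsupp]
  rw [card_insert_of_notMem (by simp [hga.symm, hha.symm]), card_insert_of_notMem (by simpa using hdist),
    card_singleton]

/-! ## Bochert's bound -/

omit [DecidableEq α] in
/-- Restriction to the complement of a "free" set is injective: if no non-identity element of `G` is supported inside
`Γ`, then two elements of `G` agreeing on `Γᶜ` are equal. -/
theorem eq_of_agree_on_compl [DecidableEq α] {G : Subgroup (Perm α)} {Γ : Finset α}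
    (hP : ∀ g : Perm α, g ∈ G → g.support ⊆ Γ → g = 1) {g₁ g₂ : Perm α} (h₁ : g₁ ∈ G) (h₂ : g₂ ∈ G)
    (hagree : ∀ x, x ∉ Γ → g₁ x = g₂ x) : g₁ = g₂ := by
  have hsupp : (g₂⁻¹ * g₁).support ⊆ Γ := by
    intro x hx
    by_contra hxΓ
    rw [mem_support, Perm.mul_apply, hagree x hxΓ] at hx
    exact hx (by simp)
  have h1 : g₂⁻¹ * g₁ = 1 := hP _ (G.mul_mem (G.inv_mem h₂) h₁) hsupp
  calc g₁ = g₂ * (g₂⁻¹ * g₁) := by group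
    _ = g₂ := by rw [h1, mul_one]

/-- If no non-identity element of `G ≤ Sym(α)` is supported inside `Γ`, then `|Γ|! · |G| ≤ |α|!`: elements of `G` are
determined by their restrictions to `Γᶜ`, which are injections `Γᶜ ↪ α`. [Cameron 1999, Ex. 4.22] -/
theorem factorial_mul_card_le_of_free {G : Subgroup (Perm α)} {Γ : Finset α}
    (hP : ∀ g : Perm α, g ∈ G → g.support ⊆ Γ → g = 1) :
    Γ.card ! * Nat.card G ≤ (Fintype.card α)! := by
  classical
  set n := Fintype.card α
  let f : G → ({x // x ∈ Γᶜ} ↪ α) := fun g =>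
    ⟨fun x => (g : Perm α) x, fun x y hxy => Subtype.ext ((g : Perm α).injective hxy)⟩
  have hf : Function.Injective f := by
    intro g₁ g₂ h12
    apply Subtype.ext
    refine eq_of_agree_on_compl hP g₁.2 g₂.2 (fun x hx => ?_)
    have := congrArg (fun e : {x // x ∈ Γᶜ} ↪ α => e ⟨x, mem_compl.2 hx⟩) h12
    simpa [f] using this
  have hcard : Nat.card G ≤ Nat.card ({x // x ∈ Γᶜ} ↪ α) := Nat.card_le_card_of_injective f hf
  rw [Nat.card_eq_fintype_card (α := ({x // x ∈ Γᶜ} ↪ α)), Fintype.card_embedding_eq, Fintype.card_coe,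
    Finset.card_compl] at hcard
  have hΓle : Γ.card ≤ n := Finset.card_le_univ Γ
  have key := Nat.factorial_mul_descFactorial (Nat.sub_le n Γ.card)
  rw [Nat.sub_sub_self hΓle] at key
  calc Γ.card ! * Nat.card G ≤ Γ.card ! * n.descFactorial (n - Γ.card) := Nat.mul_le_mul_left _ hcard
    _ = n ! := key

/-- **Bochert's bound (1889).** A primitive subgroup `G` of `Sym(α)` which does not contain `Alt(α)` has index at least
`⌈|α|/2⌉!`: `⌈|α|/2⌉! · |G| ≤ |α|!`. Proof after Cameron, *Permutation Groups*, Ex. 4.22, from Jordan's theorem on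
primitive groups containing a 3-cycle. [Bochert 1889; Cameron 1999, Ex. 4.22] -/
theorem bochert_bound {G : Subgroup (Perm α)} (hG : MulAction.IsPreprimitive G α)
    (hA : ¬ alternatingGroup α ≤ G) :
    ((Fintype.card α + 1) / 2)! * Nat.card G ≤ (Fintype.card α)! := by
  classical
  set n := Fintype.card α
  let P : Finset α → Prop := fun Γ => ∀ g : Perm α, g ∈ G → g.support ⊆ Γ → g = 1
  have hP0 : P ∅ := fun g _ hg => support_eq_empty_iff.1 (subset_empty.1 hg)
  obtain ⟨Γ, hΓmem, hΓmax⟩ := Finset.exists_max_image ((univ : Finset (Finset α)).filter P) Finset.card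
    ⟨∅, mem_filter.2 ⟨mem_univ _, hP0⟩⟩
  have hPΓ : P Γ := (mem_filter.1 hΓmem).2
  have hmax : ∀ Γ', P Γ' → Γ'.card ≤ Γ.card := fun Γ' h => hΓmax Γ' (mem_filter.2 ⟨mem_univ _, h⟩)
  have hbound : Γ.card ! * Nat.card G ≤ n ! := factorial_mul_card_le_of_free hPΓ
  by_cases hbig : (n + 1) / 2 ≤ Γ.card
  · calc ((n + 1) / 2)! * Nat.card G ≤ Γ.card ! * Nat.card G :=
          Nat.mul_le_mul_right _ (Nat.factorial_le hbig)
      _ ≤ n ! := hbound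
  · exfalso
    push Not at hbig
    have hlt : Γ.card < Γᶜ.card := by
      rw [Finset.card_compl]
      have : Γ.card ≤ n := Finset.card_le_univ Γ
      omega
    -- a non-identity element supported in `Γᶜ`
    have hnP : ¬ P Γᶜ := fun h => absurd (hmax _ h) (not_le.2 hlt)
    obtain ⟨g, hgG, hgsupp, hg1⟩ : ∃ g : Perm α, g ∈ G ∧ g.support ⊆ Γᶜ ∧ g ≠ 1 := by
      by_contra hcon
      push Not at hcon
      exact hnP fun g hg hs => hcon g hg hs
    obtain ⟨a, ha⟩ : g.support.Nonempty := by
      rw [Finset.nonempty_iff_ne_empty, Ne, support_eq_empty_iff]; exact hg1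
    have haΓ : a ∉ Γ := mem_compl.1 (hgsupp ha)
    -- a non-identity element supported in `Γ + a`
    have hnP' : ¬ P (insert a Γ) := fun h => by
      have := hmax _ h
      rw [card_insert_of_notMem haΓ] at this
      omega
    obtain ⟨h, hhG, hhsupp, hh1⟩ : ∃ h : Perm α, h ∈ G ∧ h.support ⊆ insert a Γ ∧ h ≠ 1 := by
      by_contra hcon
      push Not at hcon
      exact hnP' fun g hg hs => hcon g hg hs
    have hah : a ∈ h.support := by
      by_contra hah
      have hsub : h.support ⊆ Γ := fun x hx => by
        rcases mem_insert.1 (hhsupp hx) with rfl | h'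
        · exact absurd hx hah
        · exact h'
      exact hh1 (hPΓ h hhG hsub)
    -- the supports meet exactly in `{a}`
    have hinter : g.support ∩ h.support = {a} := by
      ext x
      simp only [mem_inter, mem_singleton]
      constructor
      · rintro ⟨hxg, hxh⟩
        have h1 := mem_compl.1 (hgsupp hxg)
        rcases mem_insert.1 (hhsupp hxh) with rfl | h2
        · rfl
        · exact absurd h2 h1
      · rintro rfl; exact ⟨ha, hah⟩
    have h3 := isThreeCycle_comm_of_support_inter hinter
    have hmem : g * h * g⁻¹ * h⁻¹ ∈ G :=
      G.mul_mem (G.mul_mem (G.mul_mem hgG hhG) (G.inv_mem hgG)) (G.inv_mem hhG)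
    exact hA (alternatingGroup_le_of_isPreprimitive_of_isThreeCycle_mem hG h3 hmem)

/-- **Bochert's bound**, closed form (registered stub `bochert` of `stmt-PneNP-10680`): for every primitive
`G ≤ Sym(α)` not containing `Alt(α)`, `⌈|α|/2⌉! · |G| ≤ |α|!`. [Bochert 1889; Cameron 1999, Ex. 4.22] -/
theorem bochert : ∀ {α : Type} [Fintype α] [DecidableEq α] (G : Subgroup (Equiv.Perm α)), MulAction.IsPreprimitive G α → ¬ alternatingGroup α ≤ G → ((Fintype.card α + 1) / 2).factorial * Nat.card G ≤ (Fintype.card α).factorial :=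
  fun _ hG hA => bochert_bound hG hA

end Summit.PneNP.PneNP.Theorems
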